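import Mathlib
import HarnessLib
import Summits.CriticalPhenomena.PercolationContinuityZ3.Theses.PercLayerChain
import
  Summits.CriticalPhenomena.PercolationContinuityZ3.Theorems.PercLowPointHalfSpaceLowPointIdentity
import Literature.Probability.Percolation.HalfSpacePinnedPairs
import Literature.Probability.Percolation.HalfSpaceProofs
import Literature.Probability.Percolation.ConstrainedClusters

/-!
# Shadow transport (route `PercLayerChain`, item `ShadowTransport`)

Item `stmt-CriticalPhenomena-5751` (`ShadowTransport`, support, rank 9) of route
`CriticalPhenomena/PercLayerChain`: for bond percolation on `ℤ³` at `p = p_c(ℤ³)`, with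
`ℍ = {x | 0 ≤ x₀}`, floor `∂ℍ = {x₀ = 0}` and `y_t = (t, 0, 0)`, for every `t : ℕ`
`∫ D_t / W dP_{p_c} = s_t := P_{p_c}(y_t ↔ ∂ℍ in ℍ)`,
where `D_t = |C_ℍ(0) ∩ {x₀ = t}|` and `W = |C_ℍ(0) ∩ ∂ℍ|` (`Set.ncard`, real quotient) are the
height-`t` and floor sections of the half-space cluster `C_ℍ(0) = halfSpaceCluster ω` of the origin.

## Proof (footprint-normalised horizontal mass transport)

* **Rooted side, pointwise.** When `C_ℍ(0)` is finite (which holds `P_{p_c}`-a.s. by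
  Barsky–Grimmett–Newman, `ae_finite_halfSpaceCluster`), `W ≥ 1` and
  `D_t / W = Σ_v 𝟙{v₀ = t, 0 ↔ v in ℍ} · |C_ℍ(0) ∩ ∂ℍ|⁻¹` (an `ℝ≥0∞`-valued sum over `v ∈ ℤ³`,
  with the `ℕ∞`-valued footprint `halfSpaceFootprint`).
* **Transport.** Tonelli, then invariance of `P_{p_c}` under the horizontal shift by
  `v - y_t` for each term (`lintegral_shift`, from `bondPercolation_map_shift`), then Tonelli back.
* **Un-rooted side, pointwise.** The shifted sum is
  `Σ_a 𝟙{a ∈ B_t} · |C_ℍ(a) ∩ ∂ℍ|⁻¹` over floor points `a`, where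
  `B_t = {a ∈ ∂ℍ | a ↔ y_t in ℍ}` is the floor block of `y_t`; for `a ∈ B_t` root invariance
  gives `C_ℍ(a) ∩ ∂ℍ = B_t`, so the sum is `|B_t| · |B_t|⁻¹ = 𝟙{B_t ≠ ∅} = 𝟙{y_t ↔ ∂ℍ in ℍ}`
  as soon as `B_t` is finite — again a.s., since a.s. every shifted half-space cluster is finite
  (`ae_forall_finite_halfSpaceCluster_shift`).

Sources: R. Lyons – Y. Peres, *Probability on Trees and Networks* (2016), §8.2 (mass transport);
G. Grimmett, *Percolation* (1999), Thm. (7.35) (Barsky–Grimmett–Newman, proved in tree as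
`BarskyGrimmettNewman1991_Z3_holds`). The deterministic shift lemmas and the a.s. finiteness are
reused from `PercLowPointHalfSpaceLowPointIdentity{,Shift}.lean` (namespace `LowPoint`).
-/

noncomputable section

namespace Summit.CriticalPhenomena.PercolationContinuityZ3.Theorems

open MeasureTheory Literature.Probability.Percolation Literature.Probability.LatticeModels
open scoped ENNReal

namespace ShadowTransport

open LowPoint

/-- The tree's `halfSpace 3` is the route file's `{x | 0 ≤ x₀}`. [folklore] -/
theorem halfSpace_three_eq : halfSpace 3 = ({x : Site 3 | 0 ≤ x 0} : Set (Site 3)) := rfl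

/-- The first coordinate of `y_t = Pi.single 0 t` is `t`. [folklore] -/
theorem single_apply_zero (t : ℕ) : (Pi.single 0 (t : ℤ) : Site 3) 0 = (t : ℤ) :=
  Pi.single_eq_same _ _

/-! ## The rooted side, pointwise -/

/-- **Rooted side.** If the half-space cluster of the origin is finite, the section ratio
`D_t / W` (real quotient of `ncard`s, read in `ℝ≥0∞`) is the sum over `v` of
`𝟙{v₀ = t, 0 ↔ v in ℍ} · |C_ℍ(0) ∩ ∂ℍ|⁻¹`. [folklore] -/
theorem ofReal_ratio_eq_tsum (t : ℕ) (ω : BondConfig (Site 3))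
    (hfin : (halfSpaceCluster ω).Finite) :
    ENNReal.ofReal ((({v : Site 3 | v 0 = (t : ℤ) ∧ ω ∈ openConnIn (halfSpace 3) 0 v}.ncard : ℝ) /
        ({v : Site 3 | v 0 = 0 ∧ ω ∈ openConnIn (halfSpace 3) 0 v}.ncard : ℝ))) =
      ∑' v : Site 3,
        {ω' : BondConfig (Site 3) | v 0 = (t : ℤ) ∧ ω' ∈ openConnIn (halfSpace 3) 0 v}.indicator
          (fun ω' => (((halfSpaceFootprint ω' : ℕ∞) : ℝ≥0∞))⁻¹) ω := by
  set D : Set (Site 3) := {v : Site 3 | v 0 = (t : ℤ) ∧ ω ∈ openConnIn (halfSpace 3) 0 v} with hDdef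
  set W : Set (Site 3) := {v : Site 3 | v 0 = 0 ∧ ω ∈ openConnIn (halfSpace 3) 0 v} with hWdef
  have hDsub : D ⊆ halfSpaceCluster ω := fun v hv => hv.2
  have hWsub : W ⊆ halfSpaceCluster ω := fun v hv => hv.2
  have hDfin : D.Finite := hfin.subset hDsub
  have hWfin : W.Finite := hfin.subset hWsub
  have hW0 : (0 : Site 3) ∈ W := ⟨rfl, conn_refl ω (zero_mem_halfSpace 3)⟩
  have hWpos : 0 < W.ncard := (Set.ncard_pos hWfin).2 ⟨0, hW0⟩
  have hfoot : halfSpaceFootprint ω = W.encard := by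
    rw [halfSpaceFootprint_def]
    congr 1
    ext v
    simp only [Set.mem_inter_iff, mem_halfSpaceCluster_iff, Set.mem_setOf_eq, hWdef]
    exact and_comm
  -- the sum is `|D| · footprint⁻¹`
  have hterm : ∀ v : Site 3,
      {ω' : BondConfig (Site 3) | v 0 = (t : ℤ) ∧ ω' ∈ openConnIn (halfSpace 3) 0 v}.indicator
        (fun ω' => (((halfSpaceFootprint ω' : ℕ∞) : ℝ≥0∞))⁻¹) ω =
      D.indicator (fun _ => (((halfSpaceFootprint ω : ℕ∞) : ℝ≥0∞))⁻¹) v := by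
    intro v
    by_cases hv : v ∈ D
    · rw [Set.indicator_of_mem
        (show ω ∈ {ω' | v 0 = (t : ℤ) ∧ ω' ∈ openConnIn (halfSpace 3) 0 v} from hv),
        Set.indicator_of_mem hv]
    · rw [Set.indicator_of_notMem
        (show ω ∉ {ω' | v 0 = (t : ℤ) ∧ ω' ∈ openConnIn (halfSpace 3) 0 v} from hv),
        Set.indicator_of_notMem hv]
  rw [tsum_congr hterm, ← tsum_subtype, ENNReal.tsum_set_const, hfoot, ← hDfin.cast_ncard_eq,
    ← hWfin.cast_ncard_eq, ENat.toENNReal_coe, ENat.toENNReal_coe,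
    ENNReal.ofReal_div_of_pos (by exact_mod_cast hWpos), ENNReal.ofReal_natCast,
    ENNReal.ofReal_natCast, div_eq_mul_inv]

/-- The summands of the rooted side are measurable in `ω`. [folklore] -/
theorem measurable_summand (t : ℕ) (v : Site 3) :
    Measurable fun ω : BondConfig (Site 3) =>
      {ω' : BondConfig (Site 3) | v 0 = (t : ℤ) ∧ ω' ∈ openConnIn (halfSpace 3) 0 v}.indicator
        (fun ω' => (((halfSpaceFootprint ω' : ℕ∞) : ℝ≥0∞))⁻¹) ω := by
  refine Measurable.indicator ?_ ?_
  · exact ((Measurable.of_discrete (f := fun n : ℕ∞ => (n : ℝ≥0∞))).comp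
      measurable_halfSpaceFootprint).inv
  · exact (MeasurableSet.const (v 0 = (t : ℤ))).inter
      (measurableSet_openConnIn_of_countable (halfSpace 3) 0 v)

/-! ## The un-rooted side, pointwise -/

/-- For a floor point `a` joined to `y` inside `ℍ`, the floor section of the half-space cluster
of `a` is the floor block `{b ∈ ∂ℍ | b ↔ y in ℍ}` of `y` (root invariance). [folklore] -/
theorem floor_section_eq_block {ω : BondConfig (Site 3)} {a y : Site 3}
    (ha : ω ∈ openConnIn (halfSpace 3) a y) :
    {u : Site 3 | ω ∈ openConnIn (halfSpace 3) a u} ∩ {u | u 0 = 0} =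
      {b : Site 3 | b 0 = 0 ∧ ω ∈ openConnIn (halfSpace 3) b y} := by
  ext u
  simp only [Set.mem_inter_iff, Set.mem_setOf_eq]
  constructor
  · rintro ⟨hau, hu0⟩
    exact ⟨hu0, conn_trans (conn_symm hau) ha⟩
  · rintro ⟨hu0, huy⟩
    exact ⟨conn_trans ha (conn_symm huy), hu0⟩

/-- The half-space cluster of a floor point `a` is finite as soon as the half-space cluster of
the origin of the configuration shifted by `-a` is. [folklore] -/
theorem finite_cluster_of_floor_point {ω : BondConfig (Site 3)} {a : Site 3} (ha0 : a 0 = 0)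
    (hfin : (halfSpaceCluster (BondConfig.relabel (sym2Equiv (Site.shift (-a))) ω)).Finite) :
    {u : Site 3 | ω ∈ openConnIn (halfSpace 3) a u}.Finite := by
  have hpre : {u : Site 3 | ω ∈ openConnIn (halfSpace 3) a u} ⊆
      (fun u : Site 3 => u - a) ⁻¹'
        halfSpaceCluster (BondConfig.relabel (sym2Equiv (Site.shift (-a))) ω) := by
    intro u hu
    have hu' : ω ∈ openConnIn (halfSpace 3) a u := hu
    rw [Set.mem_preimage, mem_halfSpaceCluster_shift_iff]
    simp only [neg_neg, Pi.neg_apply, sub_neg_eq_add, sub_add_cancel, ha0, neg_zero,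
      ← halfSpace_three_eq]
    exact hu'
  exact (hfin.preimage sub_left_injective.injOn).subset hpre

/-- **Un-rooted side.** If every shifted half-space cluster of `ω` is finite, then summing the
rooted summand at `v` over the configuration shifted horizontally by `v - y_t` gives the
indicator of `{y_t ↔ ∂ℍ in ℍ}`: the non-zero terms are those with `y_t - v` in the floor block
`B_t` of `y_t`, each equal to `|B_t|⁻¹`. [folklore] -/
theorem tsum_shift_eq_indicator (t : ℕ) (ω : BondConfig (Site 3))
    (hfin : ∀ s : Site 3,
      (halfSpaceCluster (BondConfig.relabel (sym2Equiv (Site.shift s)) ω)).Finite) :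
    ∑' v : Site 3,
        {ω' : BondConfig (Site 3) | v 0 = (t : ℤ) ∧ ω' ∈ openConnIn (halfSpace 3) 0 v}.indicator
          (fun ω' => (((halfSpaceFootprint ω' : ℕ∞) : ℝ≥0∞))⁻¹)
            (BondConfig.relabel (sym2Equiv (Site.shift (v - Pi.single 0 (t : ℤ)))) ω) =
      {ω' : BondConfig (Site 3) | ∃ w : Site 3, w 0 = 0 ∧
          ω' ∈ openConnIn (halfSpace 3) (Pi.single 0 (t : ℤ)) w}.indicator 1 ω := by
  set e : Site 3 := Pi.single 0 (t : ℤ) with hedef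
  have he0 : e 0 = (t : ℤ) := single_apply_zero t
  -- the floor block of `y_t`
  set B : Set (Site 3) := {b : Site 3 | b 0 = 0 ∧ ω ∈ openConnIn (halfSpace 3) b e} with hBdef
  -- termwise identification
  have hterm : ∀ v : Site 3,
      {ω' : BondConfig (Site 3) | v 0 = (t : ℤ) ∧ ω' ∈ openConnIn (halfSpace 3) 0 v}.indicator
        (fun ω' => (((halfSpaceFootprint ω' : ℕ∞) : ℝ≥0∞))⁻¹)
          (BondConfig.relabel (sym2Equiv (Site.shift (v - e))) ω) =
      B.indicator (fun _ => (((B.encard : ℕ∞) : ℝ≥0∞))⁻¹) (e - v) := by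
    intro v
    by_cases hv : v 0 = (t : ℤ)
    · have hs0 : (v - e) 0 = 0 := by rw [Pi.sub_apply, hv, he0, sub_self]
      have hconn : BondConfig.relabel (sym2Equiv (Site.shift (v - e))) ω ∈
          openConnIn (halfSpace 3) 0 v ↔ ω ∈ openConnIn (halfSpace 3) (e - v) e := by
        have h := mem_halfSpaceCluster_shift_iff (v - e) v ω
        rw [mem_halfSpaceCluster_iff] at h
        rw [h, hs0, neg_zero, neg_sub, sub_sub_cancel, ← halfSpace_three_eq]
      have hfoot : halfSpaceFootprint (BondConfig.relabel (sym2Equiv (Site.shift (v - e))) ω) =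
          ({u : Site 3 | ω ∈ openConnIn (halfSpace 3) (e - v) u} ∩ {u | u 0 = 0}).encard := by
        rw [footprint_shift_eq, hs0, neg_zero, neg_sub, ← halfSpace_three_eq]
      by_cases hB : e - v ∈ B
      · have hmem : BondConfig.relabel (sym2Equiv (Site.shift (v - e))) ω ∈
            {ω' : BondConfig (Site 3) | v 0 = (t : ℤ) ∧ ω' ∈ openConnIn (halfSpace 3) 0 v} :=
          ⟨hv, hconn.2 hB.2⟩
        rw [Set.indicator_of_mem hmem, Set.indicator_of_mem hB, hfoot,
          floor_section_eq_block hB.2]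
      · have hnot : BondConfig.relabel (sym2Equiv (Site.shift (v - e))) ω ∉
            {ω' : BondConfig (Site 3) | v 0 = (t : ℤ) ∧ ω' ∈ openConnIn (halfSpace 3) 0 v} := by
          rintro ⟨-, h⟩
          refine hB ⟨?_, hconn.1 h⟩
          rw [Pi.sub_apply, he0, hv, sub_self]
        rw [Set.indicator_of_notMem hnot, Set.indicator_of_notMem hB]
    · have hnot : BondConfig.relabel (sym2Equiv (Site.shift (v - e))) ω ∉
          {ω' : BondConfig (Site 3) | v 0 = (t : ℤ) ∧ ω' ∈ openConnIn (halfSpace 3) 0 v} :=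
        fun h => hv h.1
      have hB : e - v ∉ B := by
        rintro ⟨h, -⟩
        apply hv
        rw [Pi.sub_apply, he0] at h
        omega
      rw [Set.indicator_of_notMem hnot, Set.indicator_of_notMem hB]
  rw [tsum_congr hterm]
  have hre := (Equiv.subLeft e).tsum_eq (B.indicator fun _ => (((B.encard : ℕ∞) : ℝ≥0∞))⁻¹)
  simp only [Equiv.subLeft_apply] at hre
  rw [hre, ← tsum_subtype, ENNReal.tsum_set_const]
  by_cases hBne : B.Nonempty
  · obtain ⟨a, ha0, ha⟩ := hBne
    have hωE : ω ∈ {ω' : BondConfig (Site 3) | ∃ w : Site 3, w 0 = 0 ∧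
        ω' ∈ openConnIn (halfSpace 3) e w} := ⟨a, ha0, conn_symm ha⟩
    rw [Set.indicator_of_mem hωE, Pi.one_apply]
    have hBfin : B.Finite := by
      rw [hBdef, ← floor_section_eq_block ha]
      exact (finite_cluster_of_floor_point ha0 (hfin (-a))).subset Set.inter_subset_left
    have hN0 : ((B.encard : ℕ∞) : ℝ≥0∞) ≠ 0 := by
      rw [Ne, ENat.toENNReal_eq_zero, Set.encard_eq_zero]
      exact Set.Nonempty.ne_empty ⟨a, ha0, ha⟩
    have hNtop : ((B.encard : ℕ∞) : ℝ≥0∞) ≠ ⊤ := by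
      rw [Ne, ENat.toENNReal_eq_top]
      exact hBfin.encard_lt_top.ne
    exact ENNReal.mul_inv_cancel hN0 hNtop
  · have hωE : ω ∉ {ω' : BondConfig (Site 3) | ∃ w : Site 3, w 0 = 0 ∧
        ω' ∈ openConnIn (halfSpace 3) e w} := by
      rintro ⟨w, hw0, hw⟩
      exact hBne ⟨w, hw0, conn_symm hw⟩
    rw [Set.indicator_of_notMem hωE, Set.not_nonempty_iff_eq_empty.1 hBne, Set.encard_empty]
    simp

/-- The event `{y_t ↔ ∂ℍ in ℍ}` is measurable. [folklore] -/
theorem measurableSet_shadow (t : ℕ) :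
    MeasurableSet {ω' : BondConfig (Site 3) | ∃ w : Site 3, w 0 = 0 ∧
      ω' ∈ openConnIn (halfSpace 3) (Pi.single 0 (t : ℤ)) w} := by
  rw [Set.setOf_exists]
  exact MeasurableSet.iUnion fun w =>
    (MeasurableSet.const (w 0 = 0)).inter (measurableSet_openConnIn_of_countable (halfSpace 3) _ w)

end ShadowTransport

open ShadowTransport LowPoint in
/-- **Shadow transport** (item `stmt-CriticalPhenomena-5751`, exact signature of
`ShadowTransport`): for bond percolation on `ℤ³` at `p_c` and every `t`,
`∫ D_t / W dP_{p_c} = s_t = P_{p_c}(y_t ↔ ∂ℍ in ℍ)` — footprint-normalised horizontal mass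
transport, with the a.s. finiteness of half-space clusters (Barsky–Grimmett–Newman) handling
the `ncard` conventions on the null set. [folklore] -/
theorem shadowTransport_proof : Theses.PercLayerChain.ShadowTransport := by
  intro t
  rw [← halfSpace_three_eq]
  have hEmeas := measurableSet_shadow t
  rw [ofReal_measureReal (measure_ne_top _ _), ← lintegral_indicator_one hEmeas]
  have hae := ae_finite_halfSpaceCluster (criticalProbI 3) le_rfl
  have hae' := ae_forall_finite_halfSpaceCluster_shift (criticalProbI 3) le_rfl
  have h1 : ∫⁻ ω, ENNReal.ofReal
      ((({v : Site 3 | v 0 = (t : ℤ) ∧ ω ∈ openConnIn (halfSpace 3) 0 v}.ncard : ℝ) /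
        ({v : Site 3 | v 0 = 0 ∧ ω ∈ openConnIn (halfSpace 3) 0 v}.ncard : ℝ)))
        ∂(bondPercolation (zdGraph 3) (criticalProbI 3)) =
      ∫⁻ ω, ∑' v : Site 3,
        {ω' : BondConfig (Site 3) | v 0 = (t : ℤ) ∧ ω' ∈ openConnIn (halfSpace 3) 0 v}.indicator
          (fun ω' => (((halfSpaceFootprint ω' : ℕ∞) : ℝ≥0∞))⁻¹) ω
        ∂(bondPercolation (zdGraph 3) (criticalProbI 3)) := by
    refine lintegral_congr_ae ?_
    filter_upwards [hae] with ω hω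
    exact ofReal_ratio_eq_tsum t ω hω
  rw [h1, lintegral_tsum
    (f := fun (v : Site 3) (ω : BondConfig (Site 3)) =>
      {ω' : BondConfig (Site 3) | v 0 = (t : ℤ) ∧ ω' ∈ openConnIn (halfSpace 3) 0 v}.indicator
        (fun ω' => (((halfSpaceFootprint ω' : ℕ∞) : ℝ≥0∞))⁻¹) ω)
    fun v => (measurable_summand t v).aemeasurable]
  have h2 : (∑' v : Site 3, ∫⁻ ω,
      {ω' : BondConfig (Site 3) | v 0 = (t : ℤ) ∧ ω' ∈ openConnIn (halfSpace 3) 0 v}.indicator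
        (fun ω' => (((halfSpaceFootprint ω' : ℕ∞) : ℝ≥0∞))⁻¹) ω
        ∂(bondPercolation (zdGraph 3) (criticalProbI 3))) =
      ∑' v : Site 3, ∫⁻ ω,
        {ω' : BondConfig (Site 3) | v 0 = (t : ℤ) ∧ ω' ∈ openConnIn (halfSpace 3) 0 v}.indicator
          (fun ω' => (((halfSpaceFootprint ω' : ℕ∞) : ℝ≥0∞))⁻¹)
            (BondConfig.relabel (sym2Equiv (Site.shift (v - (Pi.single 0 (t : ℤ) : Site 3)))) ω)
        ∂(bondPercolation (zdGraph 3) (criticalProbI 3)) := by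
    refine tsum_congr fun v => ?_
    rw [lintegral_shift]
  rw [h2, ← lintegral_tsum
    (f := fun (v : Site 3) (ω : BondConfig (Site 3)) =>
      {ω' : BondConfig (Site 3) | v 0 = (t : ℤ) ∧ ω' ∈ openConnIn (halfSpace 3) 0 v}.indicator
        (fun ω' => (((halfSpaceFootprint ω' : ℕ∞) : ℝ≥0∞))⁻¹)
          (BondConfig.relabel (sym2Equiv (Site.shift (v - (Pi.single 0 (t : ℤ) : Site 3)))) ω))
    fun v => ((measurable_summand t v).comp (BondConfig.relabel _).measurable).aemeasurable]
  refine lintegral_congr_ae ?_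
  filter_upwards [hae'] with ω hω
  exact tsum_shift_eq_indicator t ω hω

end Summit.CriticalPhenomena.PercolationContinuityZ3.Theorems

end
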